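import Literature.AnabelianGeometry.EtaleTheta.Discharge.Sec5Thm57DivTransportDescentToAcirc
import Literature.AnabelianGeometry.EtaleTheta.Discharge.Sec5Thm57LabelTranslationOfFixedProfile

/-!
# [EtTh] §5, Thm. 5.7: TRANSLATION-FREENESS of a normalised transport, Frobenioid form — (T-div) assembled on the divisor side
# (pp. 247, 325–326, 330 / PDF pp. 21, 99–100, 104)

Mochizuki, *The étale theta function and its Frobenioid-theoretic manifestations*, Publ. RIMS **45** (2009): Thm. 5.7 p.330 (PDF p.104)
(«`Ψ` preserves right fraction-pairs of … an `l`-th root of the theta function … up to possible multiplication by a `2l`-th root of unity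
and possible translation by an element of … `l·ℤ`»), Prop. 5.3 (i)/(v)/(vi) pp.325–326 (PDF pp.99–100), Prop. 1.4 (i)/(ii) p.247 (PDF
p.21) [cite: MochizukiEtTh2009, Thm 5.7 p.330 (PDF p.104); Prop 5.3 (v) p.325 (PDF p.99); Prop 1.4 (i) p.247 (PDF p.21)].

Cell abc-iut, layer L2, seat abc-iut-L2-d3 (gen 7), row R532 «(T-div): hT ∧ hT′ (∃ w ∈ Aut_C(B_N)) ⇒ τ(γ̃_b) = 0» (junction note J-C5 of
abc-iut-L2-d4).  PROOF-ONLY (0 definitions, no new named fact): the ASSEMBLY of this seat's (T1) `Sec5Thm57RootDivisorsFixedOfTransport`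
(p464587), part 3 `Sec5Thm57DivTransportDescentToAcirc` and (T2) `Sec5Thm57LabelTranslationOfFixedProfile` (p465144).

RESULT **`exists_baseCompatible_anchor_labels_id_or_reflection_of_transport`** — for §5 data `𝔉` with isomorphisms isometries, `Ψ^Φ`
induced by `Ψ` ([FrdI] Thm. 4.9), Prop. 5.3 (i) on primes and (v) for every anchor at `A_⊚` (F-2497's fields `primes` / `labels`, read
for each choice `Ψ(A_⊚) ⥲ A_⊚` as print does), the printed description of `div(Θ̈) = Z₀·W₀⁻¹` (profile `θ` symmetric about `s/2`, NOT
translation-periodic) and the structural descent inputs (`φ : A_N → A_⊚`, torsor law, Galois descent, `(φ^bs)^*` injective, LINK (b)):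
EVERY NORMALISED transport `(a, b, w)` of the root pair (`hT`, `hT′`, `w` an automorphism of `B_N`) admits an anchor `ι : Ψ(A_⊚) ⥲ A_⊚`
BASE-COMPATIBLE with `a` along `φ` whose divisor transport `Ψ^Φ_{A_⊚,ι}` acts on the chain of components `Prime^ncsp ⥲ ℤ` as the
IDENTITY or as the REFLECTION `j ↦ s − j` — no translation.  This is (T-div) on the Frobenioid side: «divisor matching of the
transported theta trivialisation forces the base transport to be translation-free».  What it does NOT contain (T3): the identification
of this label action with the action of the Galois shadow `γ̃` of `Ψ` (pinned by the same anchors through `hshadow`) on the étale theta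
class — recorded as a GAP-LEDGER row by this seat; with it, R-C5's hypothesis «TransFree» follows for every normalised transport.
HONEST FRAMING: kernel-checked implication between typed statements about OUR §5 data under explicit binders (asserted nowhere);
nothing of [EtTh] is claimed for an actual curve; typed ≠ discharged; no side taken on anything downstream ([IUTchIII] Cor. 3.12).
-/

namespace Literature.AnabelianGeometry.EtaleTheta

open CategoryTheory Literature.AlgebraicGeometry.Frobenioids FrobenioidThetaDivisors

universe w v v' u u'

namespace ThetaFrobenioid

variable {C : Type u} [Category.{v} C] {D : Type u'} [Category.{v'} D] (𝔉 : ThetaFrobenioid.{w} C D)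

/-- **(T-div), Frobenioid form: a normalised transport is translation-free on the chain of components.**  See the module
docstring for the inputs.  Conclusion: an anchor `ι : Ψ(A_⊚) ⥲ A_⊚`, base-compatible with `a` along `φ` (`(a⁻¹ ≫ Ψ(φ) ≫ ι)^bs = φ^bs`),
at which `Ψ^Φ_{A_⊚,ι}` FIXES `Z₀`, `W₀` and acts on the labels of the non-cuspidal primes either by `j ↦ j` or by `j ↦ s − j`.
[cite: MochizukiEtTh2009, Thm 5.7 p.330 (PDF p.104); Prop 5.3 (v) p.325 (PDF p.99); Prop 1.4 (ii) p.247 (PDF p.21)] -/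
theorem exists_baseCompatible_anchor_labels_id_or_reflection_of_transport
    (hiso : ∀ ⦃X Y : C⦄ (c : X ≅ Y), 𝔉.pre.div c.hom = 1)
    {Ψ : C ≌ C} {e : 𝔉.PhiAcirc ≃* 𝔉.pre.Mon (𝔉.base.obj (Ψ.functor.obj 𝔉.Acirc))}
    (h : (DivisorTransportStub.ofThm49 𝔉).IsInducedBy Ψ 𝔉.Acirc e)
    {𝔓 : DivisorPrimeData 𝔉} (𝔖 : DivisorSupportData' 𝔓)
    (hc : ∀ ι : Ψ.functor.obj 𝔉.Acirc ≅ 𝔉.Acirc, CuspPreserved 𝔓 Ψ ι e)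
    (hL : ∀ ι : Ψ.functor.obj 𝔉.Acirc ≅ 𝔉.Acirc, PreservesNcspLabels 𝔓 Ψ ι e (hc ι))
    (θ : ℤ → ℚ) (s : ℤ) (hθ : ∀ j, θ (s - j) = θ j) (hper : ∀ t : ℤ, (∀ j, θ (j - t) = θ j) → t = 0)
    (hdiv : ∀ (𝔫 : Primes 𝔉.PhiAcirc) (h𝔫 : ¬ 𝔓.IsCuspidal 𝔫), 𝔖.ord 𝔫 𝔓.divTheta = θ (𝔓.ncspEquivZ ⟨𝔫, h𝔫⟩))
    {Z₀ W₀ : Algebra.GrothendieckGroup 𝔉.PhiAcirc} (hZW : 𝔓.divTheta = Z₀ * W₀⁻¹)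
    (a : Ψ.functor.obj 𝔉.AN ≅ 𝔉.AN) (b : Ψ.functor.obj 𝔉.BN ≅ 𝔉.BN) (w : Aut 𝔉.BN)
    (hT : a.inv ≫ Ψ.functor.map 𝔉.sCap ≫ b.hom = 𝔉.sCap)
    (hT' : a.inv ≫ Ψ.functor.map 𝔉.sCup ≫ b.hom = 𝔉.sCup ≫ w.hom)
    (ι₀ : Ψ.functor.obj 𝔉.Acirc ≅ 𝔉.Acirc) (φ : 𝔉.AN ⟶ 𝔉.Acirc)
    (hGal : ∀ p q : 𝔉.base.obj 𝔉.AN ⟶ 𝔉.base.obj 𝔉.Acirc, ∃ σ : Aut (𝔉.base.obj 𝔉.AN), σ.hom ≫ p = q)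
    (hGalDesc : ∀ σ : Aut (𝔉.base.obj 𝔉.AN), ∃ g : Aut 𝔉.Acirc,
      σ.hom ≫ 𝔉.base.map φ = 𝔉.base.map φ ≫ 𝔉.base.map g.hom)
    (hinjφ : Function.Injective (AlgebraicGeometry.Frobenioids.gpMap (𝔉.pre.pull (𝔉.base.map φ))))
    {n : ℕ}
    (hdesc : Algebra.GrothendieckGroup.of (𝔉.pre.div 𝔉.sCap) ^ n =
        AlgebraicGeometry.Frobenioids.gpMap (𝔉.pre.pull (𝔉.base.map φ)) Z₀ ∧
      Algebra.GrothendieckGroup.of (𝔉.pre.div 𝔉.sCup) ^ n =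
        AlgebraicGeometry.Frobenioids.gpMap (𝔉.pre.pull (𝔉.base.map φ)) W₀) :
    ∃ ι : Ψ.functor.obj 𝔉.Acirc ≅ 𝔉.Acirc,
      𝔉.base.map (a.inv ≫ Ψ.functor.map φ ≫ ι.hom) = 𝔉.base.map φ ∧
      ThetaFrobenioid.gpMap (psiPhi 𝔉 Ψ ι e : 𝔉.PhiAcirc →* 𝔉.PhiAcirc) Z₀ = Z₀ ∧
      ThetaFrobenioid.gpMap (psiPhi 𝔉 Ψ ι e : 𝔉.PhiAcirc →* 𝔉.PhiAcirc) W₀ = W₀ ∧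
      ((∀ (𝔭 : Primes 𝔉.PhiAcirc) (h𝔭 : ¬ 𝔓.IsCuspidal 𝔭),
          𝔓.ncspEquivZ ⟨Primes.congr (psiPhi 𝔉 Ψ ι e) 𝔭, fun h' => h𝔭 ((hc ι 𝔭).mp h')⟩ = 𝔓.ncspEquivZ ⟨𝔭, h𝔭⟩) ∨
        ∀ (𝔭 : Primes 𝔉.PhiAcirc) (h𝔭 : ¬ 𝔓.IsCuspidal 𝔭),
          𝔓.ncspEquivZ ⟨Primes.congr (psiPhi 𝔉 Ψ ι e) 𝔭, fun h' => h𝔭 ((hc ι 𝔭).mp h')⟩ = s - 𝔓.ncspEquivZ ⟨𝔭, h𝔭⟩) := by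
  obtain ⟨ι, hbc, hZ, hW⟩ := 𝔉.exists_baseCompatible_anchor_psiPhi_fixes_of_transport hiso h a b w hT hT' ι₀ φ hGal hGalDesc
    hinjφ hdesc
  have hfix : ThetaFrobenioid.gpMap (psiPhi 𝔉 Ψ ι e : 𝔉.PhiAcirc →* 𝔉.PhiAcirc) 𝔓.divTheta = 𝔓.divTheta := by
    rw [hZW, map_mul, map_inv, hZ, hW]
  exact ⟨ι, hbc, hZ, hW, psiPhi_labels_id_or_reflection_of_gpMap_divTheta_eq Ψ ι e 𝔖 (hc ι) (hL ι) θ s hθ hper hdiv hfix⟩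

end ThetaFrobenioid

end Literature.AnabelianGeometry.EtaleTheta
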